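import Summits.ResolutionOfSingularities.ResolutionOfSingularities.Theorems.FrobeniusLadderFInjectiveMacaulayficationRegularPointClause
import Literature.AlgebraicGeometry.Resolution.ComponentGluing
import Literature.AlgebraicGeometry.Resolution.QuasiExcellentSchemes
import Literature.AlgebraicGeometry.Resolution.ExcellentRingsFieldProofs
import Mathlib.AlgebraicGeometry.Noetherian
import Mathlib.AlgebraicGeometry.Morphisms.FiniteType
import HarnessLib

/-!
# HOLE #3β IN DIMENSION ≤ 3: the closed-locus STRONG⁺ step from Cossart–Piltant (conditional on F-02)
# (crux `FrobeniusLadder.FInjectiveMacaulayfication` stmt-ResolutionOfSingularities-15315, chain w45a; skeleton v22, registered stub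
# `stub_closedLocusStrongPlusStep` (#3β, strategist line `closed-centre`); lead seat res-L1-w45a-lead-1 gen 3)

[OURS · L1 W4.5a] AI-written; AI review is weaker than expert review. NOT a statement of any manuscript. CONDITIONAL on the NAMED FACT
`Literature.AlgebraicGeometry.Resolution.CossartPiltant2019General` (Cossart–Piltant 2019, Thm. 1.1 (i)+(ii): resolution of reduced
separated quasi-excellent Noetherian schemes of dimension `≤ 3` by a proper birational `π` inducing an isomorphism over `Reg X`;
FACT-LIST row F-02, admissible as a hypothesis), taken as `(hCP : CossartPiltant2019General.{0})`.

WHY THIS FILE. The v22 door re-cut hole #3 to `stub_closedLocusStrongPlusStep` (#3β): at a maximal non-closed bad point `η` of an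
admissible everywhere-Cohen–Macaulay integral `X₁`, SOME proper birational integral everywhere-CM model is an isomorphism off SOME
closed `Z ∋ η` and satisfies the full clause at every non-closed point over `Z`. The registered STRONG⁺ form it replaced demanded
`Z = closure {η}` — which even a resolution of singularities does not obviously supply (a resolution modifies all of `Sing X₁`).
THEOREM (`closedLocusStrongPlusStep_of_dim_le_three`): for `topologicalKrullDim X₁ ≤ 3`, #3β HOLDS modulo F-02, with
`Z = Sing X₁ = (Reg X₁)ᶜ` and `X₂` = the Cossart–Piltant resolution (regular ⇒ domain stalks, Cohen–Macaulay, Frobenius-closed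
parameter ideals: `RegularPointClause`; integral = reduced + irreducible, the latter by `ComponentGluing.IsBirational.irreducibleSpace`; quasi-excellence of finite-type
`k`-schemes by the tree's PROVED `Stacks07QW_field_holds`). So the open content of #3β sits in dimension `≥ 4`, and the re-cut is
consistent with everything known in dimension `≤ 3`. No definitions; one named fact as hypothesis. [folklore]
-/

set_option linter.dupNamespace false

open AlgebraicGeometry CategoryTheory Literature.AlgebraicGeometry.Resolution
open TopologicalSpace

namespace Summit.ResolutionOfSingularities.ResolutionOfSingularities.Theorems.FInjectiveMacaulayfication.ClosedLocusStepDimLeThree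

open Summit.ResolutionOfSingularities.ResolutionOfSingularities.Theorems.FInjectiveMacaulayfication

/-- **#3β in dimension ≤ 3, modulo Cossart–Piltant.** For every prime `p`, field `k` of characteristic `p`, admissible integral
everywhere-Cohen–Macaulay `X₁/k` of dimension `≤ 3` and EVERY point `η` of `X₁` at which the Frobenius clause fails (in particular
every maximal non-closed bad point): the Cossart–Piltant resolution `π : X₂ ⟶ X₁` is proper, birational, `X₂` is integral and
everywhere Cohen–Macaulay, `π` is an isomorphism off the closed set `Z = Sing X₁ ∋ η`, and the full clause holds at EVERY point of
`X₂` (a fortiori at the non-closed points over `Z`) — the `∃`-clause of the registered stub `stub_closedLocusStrongPlusStep`.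
[cite: CossartPiltant2019, Thm. 1.1 (as the hypothesis `hCP`)] -/
theorem closedLocusStrongPlusStep_of_dim_le_three (hCP : CossartPiltant2019General.{0}) :
    ∀ (p : ℕ), p.Prime → ∀ (k : Type) [Field k] [CharP k p] (X₁ : Scheme.{0}) (f₁ : X₁ ⟶ Spec (.of k)),
      IsSeparated f₁ → LocallyOfFiniteType f₁ → QuasiCompact f₁ → IsIntegral X₁ →
      (∀ x : X₁, (∀ d : ℕ, ringKrullDim (X₁.presheaf.stalk x) = d → ∀ s : Fin d → X₁.presheaf.stalk x, (Ideal.span (Set.range s)).radical.IsMaximal → RingTheory.Sequence.IsWeaklyRegular (X₁.presheaf.stalk x) (List.ofFn s))) →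
      topologicalKrullDim X₁ ≤ 3 →
      ∀ η : X₁, (¬ IsClosed ({η} : Set X₁) ∧ ¬ (∀ d : ℕ, ringKrullDim (X₁.presheaf.stalk η) = d → ∀ s : Fin d → X₁.presheaf.stalk η, (Ideal.span (Set.range s)).radical.IsMaximal → ∀ t : X₁.presheaf.stalk η, (∃ e : ℕ, t ^ p ^ e ∈ Ideal.span ((fun z : X₁.presheaf.stalk η => z ^ p ^ e) '' (Ideal.span (Set.range s) : Set (X₁.presheaf.stalk η)))) → t ∈ Ideal.span (Set.range s)) ∧
        ∀ y : X₁, y ⤳ η → y ≠ η → (∀ d : ℕ, ringKrullDim (X₁.presheaf.stalk y) = d → ∀ s : Fin d → X₁.presheaf.stalk y, (Ideal.span (Set.range s)).radical.IsMaximal → ∀ t : X₁.presheaf.stalk y, (∃ e : ℕ, t ^ p ^ e ∈ Ideal.span ((fun z : X₁.presheaf.stalk y => z ^ p ^ e) '' (Ideal.span (Set.range s) : Set (X₁.presheaf.stalk y)))) → t ∈ Ideal.span (Set.range s))) →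
        ∃ (X₂ : Scheme.{0}) (π : X₂ ⟶ X₁), IsProper π ∧ Literature.AlgebraicGeometry.Resolution.IsBirational π ∧
          IsIntegral X₂ ∧ (∀ x : X₂, (∀ d : ℕ, ringKrullDim (X₂.presheaf.stalk x) = d → ∀ s : Fin d → X₂.presheaf.stalk x, (Ideal.span (Set.range s)).radical.IsMaximal → RingTheory.Sequence.IsWeaklyRegular (X₂.presheaf.stalk x) (List.ofFn s))) ∧
          ∃ (Z : Set X₁) (hZ : IsClosed Z), η ∈ Z ∧ IsIso (π ∣_ ⟨Zᶜ, hZ.isOpen_compl⟩) ∧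
          ∀ x : X₂, π.base x ∈ Z → ¬ IsClosed ({x} : Set X₂) → (IsDomain (X₂.presheaf.stalk x) ∧ ∀ d : ℕ, ringKrullDim (X₂.presheaf.stalk x) = d → ∀ s : Fin d → X₂.presheaf.stalk x, (Ideal.span (Set.range s)).radical.IsMaximal → RingTheory.Sequence.IsWeaklyRegular (X₂.presheaf.stalk x) (List.ofFn s) ∧ ∀ t : X₂.presheaf.stalk x, (∃ e : ℕ, t ^ p ^ e ∈ Ideal.span ((fun z : X₂.presheaf.stalk x => z ^ p ^ e) '' (Ideal.span (Set.range s) : Set (X₂.presheaf.stalk x)))) → t ∈ Ideal.span (Set.range s)) := by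
  intro p hp k _ _ X₁ f₁ hsep hft hqc hint hCM hdim η hη
  haveI : Fact p.Prime := ⟨hp⟩
  haveI := hsep
  haveI := hft
  haveI := hqc
  -- `X₁` is a separated Noetherian reduced quasi-excellent scheme of dimension `≤ 3`
  haveI : X₁.IsSeparated := Scheme.isSeparated_of_isSeparated_over f₁
  haveI : IsLocallyNoetherian X₁ := LocallyOfFiniteType.isLocallyNoetherian f₁
  haveI : CompactSpace X₁ := QuasiCompact.compactSpace_of_compactSpace f₁
  haveI : IsNoetherian X₁ := {}
  have hqe : Scheme.IsQuasiExcellent X₁ := Scheme.isQuasiExcellent_of_locallyOfFiniteType Stacks07QW_field_holds f₁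
  -- the Cossart–Piltant resolution, an isomorphism over `Reg X₁`
  obtain ⟨X₂, π, hres, U, hU, hiso⟩ := hCP X₁ hqe hdim
  -- the clause at every point of the regular scheme `X₂`
  have hgood : ∀ x : X₂, IsDomain (X₂.presheaf.stalk x) ∧
      ∀ d : ℕ, ringKrullDim (X₂.presheaf.stalk x) = d → ∀ s : Fin d → X₂.presheaf.stalk x,
        (Ideal.span (Set.range s)).radical.IsMaximal → RingTheory.Sequence.IsWeaklyRegular (X₂.presheaf.stalk x) (List.ofFn s) ∧
          ∀ t : X₂.presheaf.stalk x, (∃ e : ℕ, t ^ p ^ e ∈ Ideal.span ((fun z : X₂.presheaf.stalk x => z ^ p ^ e) ''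
            (Ideal.span (Set.range s) : Set (X₂.presheaf.stalk x)))) → t ∈ Ideal.span (Set.range s) :=
    fun x => RegularPointClause.fiClause_stalk_of_isRegularLocalRing p (π ≫ f₁) x (hres.isRegular x)
  -- `X₂` is integral: reduced (domain stalks) and irreducible (birational to the integral `X₁`)
  haveI : ∀ x : X₂, IsDomain (X₂.presheaf.stalk x) := fun x => (hgood x).1
  haveI : IsReduced X₂ := isReduced_of_isReduced_stalk X₂
  haveI : IrreducibleSpace X₂ := ComponentGluing.IsBirational.irreducibleSpace hres.isBirational
  haveI : IsIntegral X₂ := isIntegral_of_irreducibleSpace_of_isReduced X₂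
  -- `Z = Sing X₁ = Uᶜ`
  have hZ : IsClosed ((U : Set X₁)ᶜ) := U.2.isClosed_compl
  have hηZ : η ∈ (U : Set X₁)ᶜ := by
    intro hηU
    rw [hU] at hηU
    exact hη.2.1 fun d hd s hs => ((RegularPointClause.fiClause_of_mem_regularLocus p f₁ η hηU).2 d hd s hs).2
  have hV : (⟨((U : Set X₁)ᶜ)ᶜ, hZ.isOpen_compl⟩ : X₁.Opens) = U := Opens.ext (compl_compl _)
  refine ⟨X₂, π, hres.isProper, hres.isBirational, inferInstance, fun x d hd s hs => ((hgood x).2 d hd s hs).1,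
    (U : Set X₁)ᶜ, hZ, hηZ, ?_, fun x _ _ => hgood x⟩
  rw [hV]
  exact hiso

end Summit.ResolutionOfSingularities.ResolutionOfSingularities.Theorems.FInjectiveMacaulayfication.ClosedLocusStepDimLeThree
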